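import Summits.QuantumFields.YangMills.Theorems.UV3BranchExpansionCountingAmortizedDiscovery
import HarnessLib

/-!
# `UV3BranchExpansionMuteDichotomy` — THE MUTE ∕ ANCHORED TRICHOTOMY of a switch site's distorted tower: the lattice glue between the
# discovery lemma (M′) and the mute-site cancellation (M) of the branch (Möbius) expansion (crux `UnitScaleTilt.HistoryTailL`,
# stmt-QuantumFields-19936 — SUPPLY side, record-independent finite combinatorics)

Cell `ym3-torus` (YM ladder rung R3 = continuum SU(2) Yang–Mills on T³ — a RUNG, NOT d = 4, NOT infinite volume, NOT a mass gap, NOT Clay);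
width seat `ym-ust-19936-w5` (gen 19), explicit-unit helper; `--supports stmt-QuantumFields-19936 --as helper`.  THEOREMS ONLY (0 `def`,
0 `sorry`, default heartbeats).

WHAT.  In LEAD ★w1's hTop spine (`Cruxes/HistoryTailL/HTopBranchExpansion.md` v1.2 §4–§6) the branch expansion is summed over switch-site
patterns `𝐬`; a pattern with a MUTE site contributes zero (lemma (M): ✓`UV3BranchExpansionMuteCancellation.socket_hM_of_mute` for a tower that
EXITS the distorted set, ✓`UV3BranchExpansionMuteCancellationDead.socket_hM_of_deadTower` for a tower that DIES — px8 g13), and a pattern all of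
whose sites have an ANCHORED distorted tower is DISCOVERABLE (lemma (M′): ✓`UV3BranchExpansionCountingAmortizedDiscovery.mem_explored_union_of_tower_of_lt`
— w2 g17) and hence counted by ✓`UV3BranchExpansionCountingAmortized(Uniform)`.  The socket ✓`UV3BranchExpansionGuardedTower.map_iterFrom_le_smul_of_branchExpansion`
needs the two halves to MEET: every pattern is discoverable or has a mute site WITH the lattice data (tower, exit chain ∕ dead end, unread-ness)
those lemmas display as hypotheses.  THIS FILE proves exactly that, in the ABSTRACT letters of the counting files (`β i` bond types, read sets `R i`,
segments `line i`, hypothesis-specified distorted sets `Dist p` and explored sets `X`, pattern `p : (i : Fin n) → Finset (β (i+1))`):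

* §1 ★ `exists_exit_chain_rel` — from a bond `b₀ ∉ Dist p (m+1)` an axial chain `b (m+1) = b₀, b i ∈ line i (b (i+1))` down to height `0` with
  `b i ∉ Dist p i`, `b i` unread by the fired bonds `p i`, `b (i+1) ∉ p i` (px8's ✓`UV3BranchExpansionDistortedSet.exists_exit_chain` in RELATIVE heights).
* §2 ★★★ `tower_trichotomy` — for a site `(κ, c)`, `c ∈ p κ`: (A) an ANCHORED distorted tower from `c` (the `htower`∕`hdist`∕`hanchor` letters of (M′)),
  or (E) a MUTE-EXIT tower (`t (κ+1) = c`, `t i ∈ line i (t (i+1))` and `t i` unread for `κ+1 ≤ i ≤ m`, `t (m+1) ∉ Dist p (m+1)`, `m+1 ≤ n`), or (D) a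
  MUTE-DEAD tower (`t m` lies on no segment, unread up to `m`, `m+1 ≤ n`) — upward induction on the height.
* §3 ★★★ `discoverable_or_exists_mute` — every pattern is DISCOVERABLE (the summation class of ✓`sum_pow_card_le_of_discoverable_of_lt`) or has a
  site with MUTE-EXIT or MUTE-DEAD data; ★★ `exists_mute_of_not_discoverable` (the form the mute class `𝓜 := {¬ discoverable}` consumes).

HOW (F-TOP) USES IT: at `β i := PBond P (j+i)` the tower∕chain letters become px8's (`t i ∈ lineF i (t (i+1)) ↔ ∃ τ < L, t i = line (t (i+1)) τ` by the
specification letter `hlineF`; «`t i ∉ Rd i C` for every constrained `C`» ⇒ «no loop word of `C` reads `t i`» by the ⊇ half of the read-set letter), so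
`𝓜 := univ.filter (¬ discoverable ∘ slices)` has `hM` from px8's two socket lemmas and its complement is counted by ✓`UV3BranchExpansionCountingT3`.

HONEST SCOPE.  [folklore] finite combinatorics on hypothesis-specified sets; nothing of (M)'s measure theory, hTop, the χ (α) record, (O‴χₛ), EX,
`HistoryTailL`, the rung R3 is proved; the Yang–Mills mass gap is NOT proved.

References: T. Bałaban, CMP **109** (1987) 249–301 [Balaban1987RG1] ((0.4) p. 253); T. Bałaban, CMP **102** (1985) 255–275 [Balaban1985UV3] ((55) p. 269);
LEAD note `Cruxes/HistoryTailL/HTopBranchExpansion.md` v1.2 §4, §4a, §5; px8 g13 ✓`UV3BranchExpansionDistortedSet`; w2 g17 ✓`…CountingAmortizedDiscovery`.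
-/

set_option autoImplicit false

namespace Summit.QuantumFields.YangMills.Theorems.UV3BranchExpansionMuteDichotomy

open Finset Function
open Summit.QuantumFields.YangMills.Theorems.UV3BranchExpansionCountingAmortizedDiscovery (mem_explored_union_of_tower_of_lt)

variable {β : ℕ → Type*} [∀ i, DecidableEq (β i)] [∀ i, Nonempty (β i)] {n : ℕ}
variable (R line : (i : ℕ) → β (i + 1) → Finset (β i))
variable (Dist : ((i : Fin n) → Finset (β ((i : ℕ) + 1))) → (i : ℕ) → Finset (β i))
variable (X : (m : ℕ) → Finset (β m) → ((i : Fin n) → Finset (β ((i : ℕ) + 1))) → (i : ℕ) → Finset (β i))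
variable (N : (i : ℕ) → Finset (β (i + 1)) → Finset (β (i + 1)))

/-! ## §1 The exit chain below a non-distorted bond (relative heights) -/

section ExitChain

omit [∀ i, Nonempty (β i)] in
/-- From `g ∉ Dist p (i+1)` (`i < n`): `g` is not fired at step `i` and some bond of its segment is neither distorted nor read by a fired bond.
[folklore] -/
theorem exists_line_free_of_not_mem_dist
    (hDistS : ∀ p (i : Fin n) (g : β ((i : ℕ) + 1)),
      g ∈ Dist p ((i : ℕ) + 1) ↔ g ∈ p i ∨ line i g ⊆ Dist p i ∪ (p i).biUnion (R i))
    (p : (i : Fin n) → Finset (β ((i : ℕ) + 1))) {i : ℕ} (hi : i < n) (g : β (i + 1)) (hg : g ∉ Dist p (i + 1)) :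
    g ∉ p ⟨i, hi⟩ ∧ ∃ b ∈ line i g, b ∉ Dist p i ∧ ∀ c' ∈ p ⟨i, hi⟩, b ∉ R i c' := by
  have h := fun H => hg ((hDistS p ⟨i, hi⟩ g).mpr H)
  refine ⟨fun hp => h (Or.inl hp), ?_⟩
  by_contra hcon
  push Not at hcon
  refine h (Or.inr fun b hb => ?_)
  rcases Decidable.em (b ∈ Dist p i) with hD | hD
  · exact Finset.mem_union_left _ hD
  · obtain ⟨c', hc', hbc'⟩ := hcon b hb hD
    exact Finset.mem_union_right _ (Finset.mem_biUnion.mpr ⟨c', hc', hbc'⟩)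

/-- ★ **THE EXIT CHAIN (relative heights).**  If `b₀ ∉ Dist p (m+1)` with `m + 1 ≤ n`, there is an axial chain `b : (i : ℕ) → β i` with `b (m+1) = b₀` and,
for every `i ≤ m`: `b i ∈ line i (b (i+1))`, `b i ∉ Dist p i`, `b i` is read by no fired bond of step `i`, and `b (i+1)` is not fired at step `i` —
px8 g13's ✓`UV3BranchExpansionDistortedSet.exists_exit_chain` re-indexed to the heights of the socket (induction on `m`, dependent `Function.update`).
[cite: Balaban1987RG1, (0.4) p.253] -/
theorem exists_exit_chain_rel
    (hDistS : ∀ p (i : Fin n) (g : β ((i : ℕ) + 1)),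
      g ∈ Dist p ((i : ℕ) + 1) ↔ g ∈ p i ∨ line i g ⊆ Dist p i ∪ (p i).biUnion (R i))
    (p : (i : Fin n) → Finset (β ((i : ℕ) + 1))) :
    ∀ m : ℕ, ∀ hm : m + 1 ≤ n, ∀ b₀ : β (m + 1), b₀ ∉ Dist p (m + 1) →
      ∃ b : (i : ℕ) → β i, b (m + 1) = b₀ ∧
        ∀ i (h : i < m + 1), b i ∈ line i (b (i + 1)) ∧ b i ∉ Dist p i ∧
          (∀ c' ∈ p ⟨i, lt_of_lt_of_le h hm⟩, b i ∉ R i c') ∧ b (i + 1) ∉ p ⟨i, lt_of_lt_of_le h hm⟩ := by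
  classical
  intro m
  induction m with
  | zero =>
    intro hm b₀ hb₀
    obtain ⟨hp, b', hb', hD, hR⟩ := exists_line_free_of_not_mem_dist R line Dist hDistS p (by omega) b₀ hb₀
    refine ⟨update (update (fun i => Classical.arbitrary (β i)) 1 b₀) 0 b', ?_, ?_⟩
    · simp
    · intro i h
      have hi0 : i = 0 := by omega
      subst hi0
      simp only [update_self]
      exact ⟨hb', hD, hR, hp⟩
  | succ m ih =>
    intro hm b₀ hb₀
    obtain ⟨hp, b', hb', hD, hR⟩ := exists_line_free_of_not_mem_dist R line Dist hDistS p (by omega) b₀ hb₀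
    obtain ⟨b, hbtop, hb⟩ := ih (by omega) b' hD
    refine ⟨update b (m + 1 + 1) b₀, by simp, ?_⟩
    intro i h
    rcases Nat.lt_or_ge i (m + 1) with hlt | hge
    · obtain ⟨h1, h2, h3, h4⟩ := hb i hlt
      have hne1 : i ≠ m + 1 + 1 := by omega
      have hne2 : i + 1 ≠ m + 1 + 1 := by omega
      rw [update_of_ne hne1, update_of_ne hne2]
      exact ⟨h1, h2, h3, h4⟩
    · have hi : i = m + 1 := by omega
      subst hi
      have hne1 : m + 1 ≠ m + 1 + 1 := by omega
      rw [update_of_ne hne1, update_self, hbtop]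
      exact ⟨hb', hD, hR, hp⟩

end ExitChain

/-! ## §2 The trichotomy of a site's distorted tower: anchored, mute-exit, or mute-dead -/

section Trichotomy

/-- ★★★ **THE MUTE ∕ ANCHORED TRICHOTOMY.**  Pattern `p`, site `(κ, c)` with `c ∈ p κ` (so `c ∈ Dist p (κ+1)`).  Following the tower of `c` upward
inside `Dist p` — at each height the bond is READ by a fired bond of that step (anchor), or it is the TOP height `n` (anchor), or it lies on NO segment
(dead end), or its segment one level up is NOT distorted (exit), or it is distorted (climb) — exactly one of:
(A) ANCHORED: `∃ l t`, `κ+1 ≤ l ≤ n`, `t (κ+1) = c`, `t i ∈ line i (t (i+1))` (`κ+1 ≤ i < l`), `t i ∈ Dist p i` (`κ+1 ≤ i ≤ l`), and `l = n` or `t l` is read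
by a fired bond of step `l` — the hypotheses of ✓`mem_explored_union_of_tower_of_lt`;
(E) MUTE-EXIT: `∃ m t`, `κ+1 ≤ m`, `m+1 ≤ n`, `t (κ+1) = c`, `t i ∈ line i (t (i+1))` and `t i` unread by the fired bonds of step `i` (`κ+1 ≤ i ≤ m`),
`t i ∈ Dist p i` (`κ+1 ≤ i ≤ m`), `t (m+1) ∉ Dist p (m+1)` — with §1 the hypotheses of ✓`socket_hM_of_mute`;
(D) MUTE-DEAD: `∃ m t`, `κ+1 ≤ m`, `m+1 ≤ n`, `t (κ+1) = c`, `t i ∈ line i (t (i+1))` (`κ+1 ≤ i < m`), unread (`κ+1 ≤ i ≤ m`), `t i ∈ Dist p i` (`κ+1 ≤ i ≤ m`),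
and `t m` lies on no segment — the hypotheses of ✓`socket_hM_of_deadTower`. [cite: Balaban1987RG1, (0.4) p.253] -/
theorem tower_trichotomy
    (hDistS : ∀ p (i : Fin n) (g : β ((i : ℕ) + 1)),
      g ∈ Dist p ((i : ℕ) + 1) ↔ g ∈ p i ∨ line i g ⊆ Dist p i ∪ (p i).biUnion (R i))
    (p : (i : Fin n) → Finset (β ((i : ℕ) + 1))) {κ : ℕ} (hκ : κ < n) {c : β (κ + 1)} (hc : c ∈ p ⟨κ, hκ⟩) :
    (∃ l : ℕ, ∃ t : (i : ℕ) → β i, κ + 1 ≤ l ∧ l ≤ n ∧ t (κ + 1) = c ∧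
        (∀ i, κ + 1 ≤ i → i < l → t i ∈ line i (t (i + 1))) ∧
        (∀ i, κ + 1 ≤ i → i ≤ l → t i ∈ Dist p i) ∧
        (l = n ∨ ∃ h : l < n, ∃ c' ∈ p ⟨l, h⟩, t l ∈ R l c')) ∨
    (∃ m : ℕ, ∃ t : (i : ℕ) → β i, κ + 1 ≤ m ∧ m + 1 ≤ n ∧ t (κ + 1) = c ∧
        (∀ i, κ + 1 ≤ i → i < m + 1 → t i ∈ line i (t (i + 1))) ∧
        (∀ i (h : i < n), κ + 1 ≤ i → i < m + 1 → ∀ c' ∈ p ⟨i, h⟩, t i ∉ R i c') ∧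
        (∀ i, κ + 1 ≤ i → i ≤ m → t i ∈ Dist p i) ∧
        t (m + 1) ∉ Dist p (m + 1)) ∨
    (∃ m : ℕ, ∃ t : (i : ℕ) → β i, κ + 1 ≤ m ∧ m + 1 ≤ n ∧ t (κ + 1) = c ∧
        (∀ i, κ + 1 ≤ i → i < m → t i ∈ line i (t (i + 1))) ∧
        (∀ i (h : i < n), κ + 1 ≤ i → i < m + 1 → ∀ c' ∈ p ⟨i, h⟩, t i ∉ R i c') ∧
        (∀ i, κ + 1 ≤ i → i ≤ m → t i ∈ Dist p i) ∧
        (∀ g : β (m + 1), t m ∉ line m g)) := by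
  classical
  -- the climbing induction: `d = n - i` decreases
  have climb : ∀ d i, n - i = d → κ + 1 ≤ i → i ≤ n → ∀ t : (i' : ℕ) → β i', t (κ + 1) = c →
      (∀ i', κ + 1 ≤ i' → i' < i → t i' ∈ line i' (t (i' + 1))) →
      (∀ i', κ + 1 ≤ i' → i' ≤ i → t i' ∈ Dist p i') →
      (∀ i' (h : i' < n), κ + 1 ≤ i' → i' < i → ∀ c' ∈ p ⟨i', h⟩, t i' ∉ R i' c') →
      ((∃ l : ℕ, ∃ t : (i : ℕ) → β i, κ + 1 ≤ l ∧ l ≤ n ∧ t (κ + 1) = c ∧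
          (∀ i, κ + 1 ≤ i → i < l → t i ∈ line i (t (i + 1))) ∧
          (∀ i, κ + 1 ≤ i → i ≤ l → t i ∈ Dist p i) ∧
          (l = n ∨ ∃ h : l < n, ∃ c' ∈ p ⟨l, h⟩, t l ∈ R l c')) ∨
      (∃ m : ℕ, ∃ t : (i : ℕ) → β i, κ + 1 ≤ m ∧ m + 1 ≤ n ∧ t (κ + 1) = c ∧
          (∀ i, κ + 1 ≤ i → i < m + 1 → t i ∈ line i (t (i + 1))) ∧
          (∀ i (h : i < n), κ + 1 ≤ i → i < m + 1 → ∀ c' ∈ p ⟨i, h⟩, t i ∉ R i c') ∧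
          (∀ i, κ + 1 ≤ i → i ≤ m → t i ∈ Dist p i) ∧
          t (m + 1) ∉ Dist p (m + 1)) ∨
      (∃ m : ℕ, ∃ t : (i : ℕ) → β i, κ + 1 ≤ m ∧ m + 1 ≤ n ∧ t (κ + 1) = c ∧
          (∀ i, κ + 1 ≤ i → i < m → t i ∈ line i (t (i + 1))) ∧
          (∀ i (h : i < n), κ + 1 ≤ i → i < m + 1 → ∀ c' ∈ p ⟨i, h⟩, t i ∉ R i c') ∧
          (∀ i, κ + 1 ≤ i → i ≤ m → t i ∈ Dist p i) ∧
          (∀ g : β (m + 1), t m ∉ line m g))) := by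
    intro d
    induction d with
    | zero =>
      -- `i = n`: anchored at the top
      intro i hd hκi hin t htc htow hdist _
      have hi : i = n := by omega
      exact Or.inl ⟨i, t, hκi, hin, htc, htow, hdist, Or.inl hi⟩
    | succ d ih =>
      intro i hd hκi hin t htc htow hdist hunread
      have hi : i < n := by omega
      -- read at height `i`?
      by_cases hr : ∃ c' ∈ p ⟨i, hi⟩, t i ∈ R i c'
      · exact Or.inl ⟨i, t, hκi, hin, htc, htow, hdist, Or.inr ⟨hi, hr⟩⟩
      · push Not at hr
        have hunread' : ∀ i' (h : i' < n), κ + 1 ≤ i' → i' < i + 1 → ∀ c' ∈ p ⟨i', h⟩, t i' ∉ R i' c' := by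
          intro i' h h1 h2 c' hc'
          rcases Nat.lt_or_ge i' i with hlt | hge
          · exact hunread i' h h1 hlt c' hc'
          · have : i' = i := by omega
            subst this
            exact hr c' hc'
        -- on a segment?
        by_cases hseg : ∃ g : β (i + 1), t i ∈ line i g
        · obtain ⟨g, hg⟩ := hseg
          have hne : κ + 1 ≠ i + 1 := by omega
          -- the extended tower
          have htc' : update t (i + 1) g (κ + 1) = c := by rw [update_of_ne hne, htc]
          have htow' : ∀ i', κ + 1 ≤ i' → i' < i + 1 → update t (i + 1) g i' ∈ line i' (update t (i + 1) g (i' + 1)) := by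
            intro i' h1 h2
            have hne1 : i' ≠ i + 1 := by omega
            rw [update_of_ne hne1]
            rcases Nat.lt_or_ge i' i with hlt | hge
            · have hne2 : i' + 1 ≠ i + 1 := by omega
              rw [update_of_ne hne2]
              exact htow i' h1 hlt
            · have : i' = i := by omega
              subst this
              rw [update_self]
              exact hg
          have hunread'' : ∀ i' (h : i' < n), κ + 1 ≤ i' → i' < i + 1 → ∀ c' ∈ p ⟨i', h⟩, update t (i + 1) g i' ∉ R i' c' := by
            intro i' h h1 h2
            have hne1 : i' ≠ i + 1 := by omega
            rw [update_of_ne hne1]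
            exact hunread' i' h h1 h2
          have hdist' : ∀ i', κ + 1 ≤ i' → i' ≤ i → update t (i + 1) g i' ∈ Dist p i' := by
            intro i' h1 h2
            have hne1 : i' ≠ i + 1 := by omega
            rw [update_of_ne hne1]
            exact hdist i' h1 h2
          by_cases hgD : g ∈ Dist p (i + 1)
          · -- climb
            refine ih (i + 1) (by omega) (by omega) (by omega) (update t (i + 1) g) htc' htow' ?_ hunread''
            intro i' h1 h2
            rcases Nat.lt_or_ge i' (i + 1) with hlt | hge
            · exact hdist' i' h1 (by omega)
            · have : i' = i + 1 := by omega
              subst this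
              rw [update_self]
              exact hgD
          · -- exit at `m = i`
            refine Or.inr (Or.inl ⟨i, update t (i + 1) g, hκi, by omega, htc', htow', hunread'', hdist', ?_⟩)
            rw [update_self]
            exact hgD
        · -- dead at `m = i`
          push Not at hseg
          exact Or.inr (Or.inr ⟨i, t, hκi, by omega, htc, htow, hunread', hdist, hseg⟩)
  -- start the climb at height `κ + 1`
  have hcD : c ∈ Dist p (κ + 1) := (hDistS p ⟨κ, hκ⟩ c).mpr (Or.inl hc)
  refine climb (n - (κ + 1)) (κ + 1) rfl le_rfl (by omega) (update (fun i => Classical.arbitrary (β i)) (κ + 1) c)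
    (update_self _ _ _) (fun i' h1 h2 => absurd h2 (by omega)) ?_ (fun i' _ h1 h2 => absurd h2 (by omega))
  intro i' h1 h2
  have : i' = κ + 1 := by omega
  subst this
  rw [update_self]
  exact hcD

end Trichotomy

/-! ## §3 Every pattern is discoverable or has a mute site -/

section Pattern

/-- ★★★ **DISCOVERABLE OR MUTE.**  For every pattern `p`: EITHER every fired bond is explored from the top distorted set or reads a side slot of an
explored ghost (the summation class of ✓`sum_pow_card_le_of_discoverable_of_lt`), OR some site `(κ, c)`, `c ∈ p κ`, carries MUTE-EXIT or MUTE-DEAD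
tower data (§2 (E)∕(D); the exit chain then by §1).  Branch (A) of the trichotomy feeds ✓`mem_explored_union_of_tower_of_lt` (w2 g17), which needs the
fired bonds to read their own segments (`hRline`). [cite: Balaban1987RG1, (0.4) p.253; Balaban1985UV3, (55) p.269] -/
theorem discoverable_or_exists_mute
    (hRline : ∀ i, i < n → ∀ g : β (i + 1), line i g ⊆ R i g)
    (hXm : ∀ m (A : Finset (β m)) p, X m A p m = A)
    (hXS : ∀ m (A : Finset (β m)) p (i : Fin n), (i : ℕ) < m →
      X m A p i = ((X m A p ((i : ℕ) + 1) \ p i).biUnion (line i) ∪ (p i).biUnion (R i)) ∩ Dist p i)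
    (hDistS : ∀ p (i : Fin n) (g : β ((i : ℕ) + 1)),
      g ∈ Dist p ((i : ℕ) + 1) ↔ g ∈ p i ∨ line i g ⊆ Dist p i ∪ (p i).biUnion (R i))
    (p : (i : Fin n) → Finset (β ((i : ℕ) + 1))) :
    (∀ i : Fin n, p i ⊆ X n (Dist p n) p ((i : ℕ) + 1) ∪ N i (X n (Dist p n) p ((i : ℕ) + 1) \ p i)) ∨
    ∃ κ : ℕ, ∃ hκ : κ < n, ∃ c ∈ p ⟨κ, hκ⟩,
      (∃ m : ℕ, ∃ t : (i : ℕ) → β i, κ + 1 ≤ m ∧ m + 1 ≤ n ∧ t (κ + 1) = c ∧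
          (∀ i, κ + 1 ≤ i → i < m + 1 → t i ∈ line i (t (i + 1))) ∧
          (∀ i (h : i < n), κ + 1 ≤ i → i < m + 1 → ∀ c' ∈ p ⟨i, h⟩, t i ∉ R i c') ∧
          (∀ i, κ + 1 ≤ i → i ≤ m → t i ∈ Dist p i) ∧
          t (m + 1) ∉ Dist p (m + 1)) ∨
      (∃ m : ℕ, ∃ t : (i : ℕ) → β i, κ + 1 ≤ m ∧ m + 1 ≤ n ∧ t (κ + 1) = c ∧
          (∀ i, κ + 1 ≤ i → i < m → t i ∈ line i (t (i + 1))) ∧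
          (∀ i (h : i < n), κ + 1 ≤ i → i < m + 1 → ∀ c' ∈ p ⟨i, h⟩, t i ∉ R i c') ∧
          (∀ i, κ + 1 ≤ i → i ≤ m → t i ∈ Dist p i) ∧
          (∀ g : β (m + 1), t m ∉ line m g)) := by
  classical
  by_cases hall : ∀ i : Fin n, p i ⊆ X n (Dist p n) p ((i : ℕ) + 1) ∪ N i (X n (Dist p n) p ((i : ℕ) + 1) \ p i)
  · exact Or.inl hall
  · right
    push Not at hall
    obtain ⟨⟨κ, hκ⟩, hnot⟩ := hall
    obtain ⟨c, hc, hcX⟩ := Finset.not_subset.mp hnot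
    refine ⟨κ, hκ, c, hc, ?_⟩
    rcases tower_trichotomy R line Dist hDistS p hκ hc with hA | hE | hD
    · -- anchored ⇒ explored: contradiction
      exfalso
      obtain ⟨l, t, hκl, hln, htc, htow, hdist, hanchor⟩ := hA
      have := mem_explored_union_of_tower_of_lt R line Dist X hRline hXm hXS p t hκl hln htow hdist hanchor
        (N κ (X n (Dist p n) p (κ + 1) \ p ⟨κ, hκ⟩))
      rw [htc] at this
      exact hcX this
    · exact Or.inl hE
    · exact Or.inr hD

/-- ★★ **THE MUTE CLASS LETTER**: a pattern that is NOT discoverable has a site with mute-exit or mute-dead tower data — the form in which the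
(F-TOP) assembly takes `𝓜 := {patterns not discoverable}` and discharges the socket's pairing hypothesis `hM` on it by px8 g13's two cancellation
lemmas. [cite: Balaban1987RG1, (0.4) p.253; Balaban1985UV3, (55) p.269] -/
theorem exists_mute_of_not_discoverable
    (hRline : ∀ i, i < n → ∀ g : β (i + 1), line i g ⊆ R i g)
    (hXm : ∀ m (A : Finset (β m)) p, X m A p m = A)
    (hXS : ∀ m (A : Finset (β m)) p (i : Fin n), (i : ℕ) < m →
      X m A p i = ((X m A p ((i : ℕ) + 1) \ p i).biUnion (line i) ∪ (p i).biUnion (R i)) ∩ Dist p i)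
    (hDistS : ∀ p (i : Fin n) (g : β ((i : ℕ) + 1)),
      g ∈ Dist p ((i : ℕ) + 1) ↔ g ∈ p i ∨ line i g ⊆ Dist p i ∪ (p i).biUnion (R i))
    (p : (i : Fin n) → Finset (β ((i : ℕ) + 1)))
    (hnd : ¬ ∀ i : Fin n, p i ⊆ X n (Dist p n) p ((i : ℕ) + 1) ∪ N i (X n (Dist p n) p ((i : ℕ) + 1) \ p i)) :
    ∃ κ : ℕ, ∃ hκ : κ < n, ∃ c ∈ p ⟨κ, hκ⟩,
      (∃ m : ℕ, ∃ t : (i : ℕ) → β i, κ + 1 ≤ m ∧ m + 1 ≤ n ∧ t (κ + 1) = c ∧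
          (∀ i, κ + 1 ≤ i → i < m + 1 → t i ∈ line i (t (i + 1))) ∧
          (∀ i (h : i < n), κ + 1 ≤ i → i < m + 1 → ∀ c' ∈ p ⟨i, h⟩, t i ∉ R i c') ∧
          (∀ i, κ + 1 ≤ i → i ≤ m → t i ∈ Dist p i) ∧
          t (m + 1) ∉ Dist p (m + 1)) ∨
      (∃ m : ℕ, ∃ t : (i : ℕ) → β i, κ + 1 ≤ m ∧ m + 1 ≤ n ∧ t (κ + 1) = c ∧
          (∀ i, κ + 1 ≤ i → i < m → t i ∈ line i (t (i + 1))) ∧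
          (∀ i (h : i < n), κ + 1 ≤ i → i < m + 1 → ∀ c' ∈ p ⟨i, h⟩, t i ∉ R i c') ∧
          (∀ i, κ + 1 ≤ i → i ≤ m → t i ∈ Dist p i) ∧
          (∀ g : β (m + 1), t m ∉ line m g)) :=
  (discoverable_or_exists_mute R line Dist X N hRline hXm hXS hDistS p).resolve_left hnd

end Pattern

end Summit.QuantumFields.YangMills.Theorems.UV3BranchExpansionMuteDichotomy
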